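/-
Copyright (c) 2026 the pub-hodgecm-mathlib formalisation cell (harness21).  Prover seat hodgecm-mathlib-K2E3-p06 (g5), Track B «K2-LIT», engine E3, unit U4 «Keys»; deal (D61)
LINE LEAD of the open leaf (U4f-χ₁-ram-one), design D-I, plan DESIGN-B v1 step (B1a) «A SECTION OF THE KERNEL FIXED BY `I ∩ N̄`» on `U(Φ₃)(L⁺_v)`;
2026-09-04.  KERNEL module: THEOREMS ONLY (no definition, no named fact, no `sorry`, no instance, no notation).
-/
import Summits.HodgeConjecture.HodgeConjecture.Theorems.K2E3BranchATypeLettersCM            -- ★ Z2A-3c (iii) p858557 (K2E3-p06 g4): `exists_iwahoriDatum_K_zero_eq_Nbar_eq`, `theta_eq_tau_of_mem`, `theta_eq_one_of_map_mem`, `exists_mem_P_mul_of_mem`; brings the frame, ★ Z2A-3b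
import Summits.HodgeConjecture.HodgeConjecture.Theorems.K2E3IwahoriDatumDilation              -- ★ Z2A-2 p858273 (K2E3-p06 g4): `exists_dilate_typeReady`
import Summits.HodgeConjecture.HodgeConjecture.Theorems.K2E3IntertwiningKernelOfReducible     -- ★ V1 p857640 (K2E3-p06 g4): `exists_section_apply_one_ne_zero_forall_intertwiningIntegral_eq_zero`
import HarnessLib

/-!
# K2 ∕ E3 «EllipticInputs», unit U4 «Keys» — (U4f-χ₁-ram-one) step (B1a) of DESIGN-B: A REDUCIBLE `i(χ₁, 1)` CONTAINS A `G`-STABLE `V` KILLED BY EVERY INTERTWINING INTEGRAL AND A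
# SECTION `f ∈ V`, `f(1) ≠ 0`, FIXED BY `I ∩ N̄` (`v` non-split; Branch-free, depth-free)   [Keys1984 §3; Casselman1995 §6.4; BruhatTits1972 (4.4.4)]

Cell hodgecm-mathlib (D-0151), FLOOR 0, Track B «K2-LIT», engine E3, crux item H413 = stmt-HodgeConjecture-24833 (route `HCCMUnconditional`, no route verbs); target BY NAME
the OPEN leaf `…K2E3EllipticInputs.U4Keys.sig_K2E3KeysThmTwoContractingRamifiedCharOne` (U4Keys ED. 7; cand v5 leaf (U4f-χ₁-ram-one-d0B)), design D-I, plan `DESIGN-B-v1`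
(`K2/K2E3-p06/g5/DESIGN-B-v1-BranchBDepthZero.K2E3-p06-g5.md`) step (B1), first half.  Author K2E3-p06 (g5), line lead (D61).  `--supports stmt-HodgeConjecture-24833 --as helper`;
THEOREMS ONLY.  NOT THE PAYER.  (The chain ★ V1 → datum → ★ Z2A-2 → ★ V2b of ★ Z2A-5 exceeds the gate's wall budget as ONE declaration; this file is its first half, the sequel
`K2E3TypeVectorInKernelDepthZero` runs ★ V2b on the section exported here.)

THE POINT.  In the (G3)-EXPLICIT frame `(w hw eA heA ϖ hϖ g₁ hg₁ K0 K1 I hK0 hK1 hI)` of ★ p857330 §3, with `w₀` (matrix `Φ₃`) and a Haar measure `μ` on `N(L⁺_v)`: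
* **`exists_fixed_section_forall_intertwiningIntegral_eq_zero`** — `v` non-split; `χ₁` continuous, non-unitary, contracting; `i(χ₁, 1)` reducible ⟹ there are a `G`-stable
  `V ≤ i(χ₁, 1)` with **`∫_N f′(w₀ n g) dμ = 0` for every `f′ ∈ V` and every `g`** (★ V1: `V = range B ⊆ ker J(w₀, χ)`) and a section **`f ∈ V`, `f(1) ≠ 0`, FIXED BY every `c ∈ I`
  with `eA c ∈ N̄_w`** (= `I ∩ N̄`; ★ datum `𝓘.K 0 = I`, `𝓘.N̄ = eA⁻¹(N̄_w)` + ★ Z2A-2 torus dilation of the `V1` section inside `V`).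
HONEST LABEL: HC_CM is proved only modulo the 7 printed citations (2 remaining named inputs: hLiu418 = stmt-HodgeConjecture-24832, h413 = stmt-HodgeConjecture-24833)
until rung 0 closes; count-neutral — this file does NOT pay the leaf; no printed citation is discharged.

## References
* [Keys1984] D. Keys, *Principal series representations of special unitary groups over local fields*, Compositio Math. 51 (1984), §3 (the operators `A(w, λ)`), §7 Thm (2) p. 126.
* [Casselman1995] W. Casselman, *Introduction to the theory of admissible representations of `p`-adic reductive groups* (1995), §6.4, Thm. 6.6.2; Prop. 1.4.4.
* [BruhatTits1972] F. Bruhat, J. Tits, Publ. Math. IHÉS 41 (1972), (4.4.4) (Iwahori factorisation).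
* [MoyPrasad1996] A. Moy, G. Prasad, Comment. Math. Helv. 71 (1996), §3 (depth-zero types).
-/

set_option autoImplicit false
-- the mandated namespace has the single-problem summit's repeated segment (`HodgeConjecture.HodgeConjecture`)
set_option linter.dupNamespace false

noncomputable section

open NumberField IsDedekindDomain MeasureTheory
open scoped Matrix MatrixGroups WithZero Valued
open Literature.NumberTheory Literature.NumberTheory.Automorphic Literature.NumberTheory.Automorphic.UnitaryGroup
open Literature.NumberTheory.Rogawski1990

namespace Summit.HodgeConjecture.HodgeConjecture.Cruxes.H413.K2E3KernelSectionFixedByIwahoriNbar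

open Summit.HodgeConjecture.HodgeConjecture.Cruxes.H413
open Summit.HodgeConjecture.HodgeConjecture.Cruxes.H413.K2E3DepthZeroIwahoriCharacterCM
open Summit.HodgeConjecture.HodgeConjecture.Cruxes.H413.K2E3BranchATypeLettersCM

variable (L : Type) [Field L] [NumberField L] [IsCMField L] (v : HeightOneSpectrum (𝓞 ↥(maximalRealSubfield L)))
  (w : PlacesOver L v) (hw : IsCMField.complexConj L • w.1 = w.1)
  (eA : Gqs L v ≃ₜ* ↥(unitaryGroupOfForm (galAdicCompletionMap (L := L) (IsCMField.complexConj L) hw) ((StdForm.antidiagonal 3).over (w.1.adicCompletion L))))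
  (heA : ∀ g : Gqs L v,
    ((eA g : ↥(unitaryGroupOfForm (galAdicCompletionMap (L := L) (IsCMField.complexConj L) hw) ((StdForm.antidiagonal 3).over (w.1.adicCompletion L)))) :
        GL (Fin 3) (w.1.adicCompletion L)) =
      ((localNonsplitEquiv (IsCMField.complexConj L) (qsForm L) (IsCMField.complexConj_ne_one L) w hw g :
        ↥(unitaryGroupOfForm (galAdicCompletionMap (L := L) (IsCMField.complexConj L) hw) (placeForm (qsForm L) w.1))) : GL (Fin 3) (w.1.adicCompletion L)))
  {ϖ : w.1.adicCompletion L} (hϖ : Valued.v ϖ = WithZero.exp (-1 : ℤ))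
  (g₁ : GL (Fin 3) (w.1.adicCompletion L)) (hg₁ : (g₁ : Matrix (Fin 3) (Fin 3) (w.1.adicCompletion L)) = Matrix.diagonal ![(1 : w.1.adicCompletion L), 1, ϖ])
  (K0 K1 I : Subgroup (Gqs L v))
  (hK0 : K0 = ((glInt 3 (w.1.adicCompletion L)).subgroupOf
    (unitaryGroupOfForm (galAdicCompletionMap (L := L) (IsCMField.complexConj L) hw) ((StdForm.antidiagonal 3).over (w.1.adicCompletion L)))).comap
      eA.toMulEquiv.toMonoidHom)
  (hK1 : K1 = (((glInt 3 (w.1.adicCompletion L)).map (MulAut.conj g₁).toMonoidHom).subgroupOf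
    (unitaryGroupOfForm (galAdicCompletionMap (L := L) (IsCMField.complexConj L) hw) ((StdForm.antidiagonal 3).over (w.1.adicCompletion L)))).comap
      eA.toMulEquiv.toMonoidHom)
  (hI : I = K0 ⊓ K1)

/-! ## §1 A `G`-stable `V` killed by every `Λ_g`, and a section in it fixed by `I ∩ N̄` -/

include hw heA hϖ hg₁ hK0 hK1 hI in
set_option maxHeartbeats 12000000 in
set_option synthInstance.maxHeartbeats 400000 in
-- the `SmoothInd` carrier of `cmPrincipalSeries`, ★ V1∕Z2A-2 instantiated on `U(Φ₃)(L⁺_v)` (class of ★ Z2A-5, whose first steps these are)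
/-- **A `G`-STABLE `V ≤ i(χ₁, 1)` KILLED BY EVERY INTERTWINING INTEGRAL, WITH A SECTION `f ∈ V`, `f(1) ≠ 0`, FIXED BY `I ∩ N̄`.**  `v` non-split; `χ₁ : (L ⊗ L⁺_v)ˣ → ℂˣ` continuous,
non-unitary, contracting; `w₀` of matrix `Φ₃`; `μ` Haar on `N(L⁺_v)`; `I = K₀ ⊓ K₁` the (G3)-frame Iwahori, `N̄_w = w N_w w` the place-model lower unipotent group.  If `i(χ₁, 1)` is
reducible then ★ V1 gives `V ≠ ⊥` with `∫_N f′(w₀ n g) dμ = 0` for all `f′ ∈ V`, `g ∈ G`, containing `f₀` with `f₀(1) ≠ 0`; the Iwahori datum (★ `exists_iwahoriDatum_K_zero_eq_Nbar_eq`: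
`𝓘.K 0 = I`, `𝓘.N̄ = eA⁻¹(N̄_w)`) and ★ Z2A-2 `exists_dilate_typeReady` replace `f₀` by a torus dilate `f ∈ V`, `f(1) ≠ 0`, fixed by `𝓘.K 0 ⊓ 𝓘.N̄ = {c ∈ I : eA c ∈ N̄_w}`.
[cite: Keys1984, §3, §7 Thm (2)] [cite: Casselman1995, §6.4; Prop. 1.4.4] [cite: BruhatTits1972, (4.4.4)] [cite: MoyPrasad1996, §3] -/
theorem exists_fixed_section_forall_intertwiningIntegral_eq_zero
    (hns : ∀ w' : PlacesOver L v, IsCMField.complexConj L • w'.1 = w'.1)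
    (χ₁ : (LocalRing L v)ˣ →* ℂˣ) (h₁ : Continuous fun x => ((χ₁ x : ℂˣ) : ℂ)) (hnu : ∃ x, ‖((χ₁ x : ℂˣ) : ℂ)‖ ≠ 1)
    (hcontr : ∀ x : (LocalRing L v)ˣ, unitModulusChar (LocalRing L v) x < 1 → ‖((χ₁ x : ℂˣ) : ℂ)‖ < 1)
    (w₀ : ↥(unitaryGroupOfForm (conjLocal L (IsCMField.complexConj L) v) (cmLocalForm L 3 v))) (hw₀ : Units.val (w₀ : GL (Fin 3) (LocalRing L v)) = cmLocalForm L 3 v)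
    [MeasurableSpace ↥(cmBorelTriple L 3 v).N] [BorelSpace ↥(cmBorelTriple L 3 v).N] (μ : Measure ↥(cmBorelTriple L 3 v).N) [μ.IsHaarMeasure]
    (hred : ∃ N : Subrepresentation (cmPrincipalSeries L 3 v (cmTorusCharPair L v χ₁ 1)), N ≠ ⊥ ∧ N ≠ ⊤) :
    ∃ (V : Subrepresentation (cmPrincipalSeries L 3 v (cmTorusCharPair L v χ₁ 1)))
      (f : haveI := locallyCompactSpace_cmBorelU L 3 v
        Representation.SmoothInd (cmBorelTriple L 3 v).P
          (Representation.twist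
            (((Representation.trivial ℂ ↥(torusU (conjLocal L (IsCMField.complexConj L) v) (cmLocalForm L 3 v)) ℂ).twist
              (cmTorusCharPair L v χ₁ 1)).comp (cmBorelTriple L 3 v).proj) (rootDeltaChar (cmBorelTriple L 3 v).P))),
      f ∈ V ∧ f.toFun 1 ≠ 0 ∧
      (∀ c : ↥(unitaryGroupOfForm (conjLocal L (IsCMField.complexConj L) v) (cmLocalForm L 3 v)), (c : Gqs L v) ∈ I →
        eA c ∈ (((borelTriple (galAdicCompletionMap (L := L) (IsCMField.complexConj L) hw) ((StdForm.antidiagonal 3).over (w.1.adicCompletion L)) rfl).N).map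
          (MulAut.conj (weylLongU (galAdicCompletionMap (L := L) (IsCMField.complexConj L) hw)
            (rfl : (StdForm.antidiagonal 3).over (w.1.adicCompletion L) = _))).toMonoidHom) →
        haveI := locallyCompactSpace_cmBorelU L 3 v
        Representation.smoothIndRep (cmBorelTriple L 3 v).P _ c f = f) ∧
      ∀ f', f' ∈ V → ∀ g : ↥(unitaryGroupOfForm (conjLocal L (IsCMField.complexConj L) v) (cmLocalForm L 3 v)),
        ∫ n : ↥(cmBorelTriple L 3 v).N, f'.toFun (w₀ * (n : ↥(unitaryGroupOfForm (conjLocal L (IsCMField.complexConj L) v) (cmLocalForm L 3 v))) * g) ∂μ = 0 := by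
  haveI := locallyCompactSpace_cmBorelU L 3 v
  -- ★ V1: a `G`-stable `V ∋ f₀`, `f₀(1) ≠ 0`, killed by every intertwining functional `Λ_g`
  have h₂ : Continuous fun x : ↥(normOneUnits (conjLocal L (IsCMField.complexConj L) v)) =>
      (((1 : ↥(normOneUnits (conjLocal L (IsCMField.complexConj L) v)) →* ℂˣ) x : ℂˣ) : ℂ) := by
    simp only [MonoidHom.one_apply]; exact continuous_const
  obtain ⟨V, f₀, hf₀V, hf₀1, hΛ⟩ :=
    K2E3IntertwiningKernelOfReducible.exists_section_apply_one_ne_zero_forall_intertwiningIntegral_eq_zero L v hns χ₁ 1 h₁ h₂ hnu hcontr hred w₀ hw₀ μ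
  -- the Iwahori datum with `K 0 = I`, `N̄ = eA⁻¹(N̄_w)`
  obtain ⟨𝓘, hK0I, hNbar⟩ := exists_iwahoriDatum_K_zero_eq_Nbar_eq L v w hw eA heA hϖ g₁ hg₁ K0 K1 I hK0 hK1 hI
  -- ★ Z2A-2 at level `0`: a dilate of `f₀` inside `V`, non-zero at `1`, fixed by `𝓘.K 0 ∩ N̄`
  obtain ⟨i, hfV, hf1, hfix⟩ := K2E3IwahoriDatumDilation.exists_dilate_typeReady (cmBorelTriple L 3 v).P _ (cmBorelTriple L 3 v) 𝓘
    (cmBorelTriple L 3 v).M_le V f₀ hf₀V hf₀1 0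
  refine ⟨V, _, hfV, hf1, fun c hcI hcN => hfix c ?_, hΛ⟩
  rw [hK0I, hNbar]
  exact Subgroup.mem_inf.2 ⟨hcI, Subgroup.mem_comap.2 hcN⟩

end Summit.HodgeConjecture.HodgeConjecture.Cruxes.H413.K2E3KernelSectionFixedByIwahoriNbar

end
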